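import Summits.ResolutionOfSingularities.ResolutionOfSingularities.Theorems.EquisingularLiftEquisingularLiftNatNDPointChart
import Summits.ResolutionOfSingularities.ResolutionOfSingularities.Theorems.EquisingularLiftEquisingularLiftNatNDAffineDictionary
import Summits.ResolutionOfSingularities.ResolutionOfSingularities.Theorems.EquisingularLiftEquisingularLiftNatNDToricStrictCoprime
import Summits.ResolutionOfSingularities.ResolutionOfSingularities.Theorems.EquisingularLiftEquisingularLiftNatNDStrataTower
import Literature.AlgebraicGeometry.Resolution.AffineCoordinateBlowupCharts
import Literature.AlgebraicGeometry.Resolution.CoordinateBlowupProperTransform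
import Literature.AlgebraicGeometry.Resolution.MarkedIdealsEtale
import Literature.AlgebraicGeometry.Resolution.StrictTransformDistinct
import Literature.AlgebraicGeometry.Resolution.BlowupDisjointCentreSplitting
import HarnessLib

/-!
# [OURS · L1 W4.5(b) · EL♮(3) · ND-K5 (B4α1i)] THE CHART CLAUSE OF `ModelInit`: every point of a blow-up of the origin of `𝔸^{m+1}` lies in a standard toric chart

WIDTH core of the ND-K5 brick (B4α1i) `modelInit` (res-L1-w45b-idea-1's spec §13.14 `ND.ToricStage` (TS1) / `ND.ModelInit`), `--supports
stmt-ResolutionOfSingularities-20148`, no claim, counted 0 (res-L1-w45b-stub-4 g11).  AI-produced kernel work weaker than expert review; no statement of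
[Hironaka2017] is used; EL♮(3) is NOT proved here.

WHAT.  `modelInit_chart`: for ANY blow-up `π₀ : A₂ → 𝔸^{m+1}_k` of the (reduced) origin and a polynomial `g ≠ 0` with a convenient table, every point of
`A₂` lies in the range of an OPEN IMMERSION `c : 𝔸^{m+1} ⟶ A₂` (Literature `AffineCoordBlowup.chartImm` at `Λ = univ`) with: cone `pointCone m j ∈
star (orthantFan (m+1)) frame`, unimodular matrix `B = pointChartMat m j`, `c ≫ π₀ = Spec (t ↦ y^B)`, the stepped frame boundary
`(frameBoundary coordHyperplane).stepAlong 𝓘{0} 𝟙 π₀` pulling back to `V(y_i)` on the cone's rays (`𝟙 ↦ V(y_j)` exceptional, `e i ↦ V(y_i)` by the strict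
transform dictionary `strictTransformIdeal_specMap_coordBlowupSubst` + `coordStrictTransformIdeal_span_singleton` + `coordProperTransform_X_of_ne`) and to `⊤`
off the cone (`e j ↦ ⊤` by `coordStrictTransformIdeal_eq_top_of_X_mem`; absent rays stay `⊤`), and the strict transform `closure (π₀⁻¹(V(g) ∖ 0))` pulling
back to `V(toricStrict B g)` (open immersions commute with closures; `(Spec subst)⁻¹{0} = V(y_j)`; `g(y^B) = y_j^h · toricStrict` off `V(y_j)` by
convenience; closure lemma with `y_j ∤ toricStrict`).  Plus the dictionary entries `coordHyperplane_eq_𝓘Λ/_eq_idealSheafOf`, `vanishingIdeal_affOrigin_eq`,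
`idealSheafOf_top'`, `preimage_specMap_coordBlowupSubst_affOrigin`, `preimage_specMap_zeroLocus`, `coordBlowupSubst_eq_chartPull`.  The chart hom is written
as `(aeval fun l => ∏ i, X i ^ B i l).toRingHom` (= `ND.toricChartHom (m+1) k B` of the port by `rfl`).
-/

set_option linter.dupNamespace false

noncomputable section

open CategoryTheory AlgebraicGeometry TopologicalSpace MvPolynomial
open Literature.AlgebraicGeometry.Resolution
open AlgebraicGeometry.Scheme.IdealSheafData

namespace Summit.ResolutionOfSingularities.ResolutionOfSingularities.Cruxes.EquisingularLiftNat.Sections.ND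

variable (m : ℕ) (k : Type) [Field k]

/-! ## Small dictionary entries for `𝔸^{m+1}` -/

/-- The coordinate hyperplane ideal sheaf is the coordinate-subspace ideal `𝓘_{ {i} }`. [OURS · dictionary] -/
theorem coordHyperplane_eq_𝓘Λ (i : Fin (m + 1)) : coordHyperplane (m + 1) k i = AffineCoordBlowup.𝓘Λ m k {i} := by
  unfold coordHyperplane AffineCoordBlowup.𝓘Λ AffineCoordBlowup.CΛ
  congr 1
  apply Closeds.ext
  change PrimeSpectrum.zeroLocus {(X i : MvPolynomial (Fin (m + 1)) k)} =
    PrimeSpectrum.zeroLocus ((Ideal.span (X '' ({i} : Set (Fin (m + 1))) : Set (MvPolynomial (Fin (m + 1)) k)) : Ideal (MvPolynomial (Fin (m + 1)) k)) :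
      Set (MvPolynomial (Fin (m + 1)) k))
  rw [Set.image_singleton, PrimeSpectrum.zeroLocus_span]

/-- The coordinate hyperplane ideal sheaf as `idealSheafOf (xᵢ)`. [OURS · dictionary] -/
theorem coordHyperplane_eq_idealSheafOf (i : Fin (m + 1)) :
    coordHyperplane (m + 1) k i = Hironaka2005.idealSheafOf (Ideal.span {(X i : MvPolynomial (Fin (m + 1)) k)}) := by
  rw [coordHyperplane_eq_𝓘Λ, 𝓘Λ_eq_idealSheafOf, AffineCoordBlowup.IΛ, Set.image_singleton]

/-- The ideal sheaf of the origin is the coordinate-subspace ideal of the full frame. [OURS · dictionary] -/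
theorem vanishingIdeal_affOrigin_eq :
    vanishingIdeal (⟨{affOrigin (m + 1) k}, isClosed_affOrigin (m + 1) k⟩ : Closeds (Aff (m + 1) k)) = AffineCoordBlowup.𝓘Λ m k Set.univ := by
  rw [AffineCoordBlowup.𝓘Λ_univ]; rfl

/-- `idealSheafOf ⊤ = ⊤`. [OURS · dictionary] -/
theorem idealSheafOf_top' {R : Type} [CommRing R] : Hironaka2005.idealSheafOf (⊤ : Ideal R) = ⊤ := by
  refine Scheme.IdealSheafData.ext_of_isAffine ?_
  rw [ideal_idealSheafOf_top, Ideal.map_top, Scheme.IdealSheafData.ideal_top, Pi.top_apply]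

/-- The point blow-up's chart map pulls the origin back to the exceptional hyperplane: `(Spec subst_j)⁻¹ {0} = V(y_j)`. [OURS · dictionary] -/
theorem preimage_specMap_coordBlowupSubst_affOrigin (j : Fin (m + 1)) :
    (Spec.map (CommRingCat.ofHom (coordBlowupSubst k (Set.univ : Set (Fin (m + 1))) j).toRingHom)).base ⁻¹' {affOrigin (m + 1) k} =
      PrimeSpectrum.zeroLocus {(X j : MvPolynomial (Fin (m + 1)) k)} := by
  ext p
  rw [Set.mem_preimage, Set.mem_singleton_iff]
  change PrimeSpectrum.comap (coordBlowupSubst k (Set.univ : Set (Fin (m + 1))) j).toRingHom p = affOrigin (m + 1) k ↔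
    {(X j : MvPolynomial (Fin (m + 1)) k)} ⊆ (p.asIdeal : Set (MvPolynomial (Fin (m + 1)) k))
  rw [Set.singleton_subset_iff, SetLike.mem_coe, PrimeSpectrum.ext_iff]
  change Ideal.comap _ p.asIdeal = originIdeal k (m + 1) ↔ _
  constructor
  · intro h
    have hx : (X j : MvPolynomial (Fin (m + 1)) k) ∈ originIdeal k (m + 1) := by
      rw [originIdeal, RingHom.mem_ker, constantCoeff_X]
    rw [← h, Ideal.mem_comap] at hx
    simpa using hx
  · intro h
    have hle : originIdeal k (m + 1) ≤ Ideal.comap (coordBlowupSubst k (Set.univ : Set (Fin (m + 1))) j).toRingHom p.asIdeal := by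
      rw [originIdeal_eq_span k (m + 1), Ideal.span_le]
      rintro _ ⟨l, rfl⟩
      rw [SetLike.mem_coe, Ideal.mem_comap]
      change coordBlowupSubst k Set.univ j (X l) ∈ p.asIdeal
      rw [coordBlowupSubst_X]
      split_ifs
      · exact Ideal.mul_mem_right _ _ h
      · rename_i hl; simp only [Set.mem_univ, true_and, not_not] at hl; rw [hl]; exact h
    exact ((originIdeal.isMaximal k (m + 1)).eq_of_le (Ideal.IsPrime.ne_top inferInstance) hle).symm

/-- The point blow-up's chart map pulls `V(g)` back to `V(g(y^B))`. [OURS · dictionary] -/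
theorem preimage_specMap_zeroLocus {R S : Type} [CommRing R] [CommRing S] (φ : R →+* S) (g : R) :
    (Spec.map (CommRingCat.ofHom φ)).base ⁻¹' PrimeSpectrum.zeroLocus {g} = PrimeSpectrum.zeroLocus {φ g} := by
  ext p
  rw [Set.mem_preimage]
  change {g} ⊆ ((PrimeSpectrum.comap φ p).asIdeal : Set R) ↔ {φ g} ⊆ (p.asIdeal : Set S)
  rw [Set.singleton_subset_iff, Set.singleton_subset_iff, SetLike.mem_coe, SetLike.mem_coe, PrimeSpectrum.comap_asIdeal, Ideal.mem_comap]

/-- The chart pull-back `g(y^B)` for the point-chart matrix is the substitution `coordBlowupSubst k univ j g`. [OURS · dictionary] -/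
theorem coordBlowupSubst_eq_chartPull (j : Fin (m + 1)) (g : MvPolynomial (Fin (m + 1)) k) :
    coordBlowupSubst k (Set.univ : Set (Fin (m + 1))) j g = chartPull (pointChartMat m j) g := by
  rw [chartPull_eq_aeval]
  have := congrArg (fun φ : MvPolynomial (Fin (m + 1)) k →+* MvPolynomial (Fin (m + 1)) k => φ g) (toricChartHom_pointChartMat m k j)
  simpa using this.symm

/-! ## The (TS1) chart clause of `ModelInit` -/

/-- **(TS1) for `ModelInit`.**  For ANY blow-up `π₀ : A₂ → 𝔸^{m+1}_k` of the origin and a convenient `g ≠ 0`, every point of `A₂` lies in a standard chart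
`c = chartImm j : 𝔸^{m+1} ⟶ A₂` (open immersion) with cone `pointCone m j ∈ star (orthantFan (m+1)) frame`, unimodular matrix `pointChartMat m j`,
`c ≫ π₀ = Spec (y ↦ y^B)`, the stepped frame boundary pulling back to the coordinate hyperplanes (new ray `𝟙 ↦ V(y_j)`, `e i ↦ V(y_i)`) resp. `⊤` off the
cone, and the strict transform of `V(g)` pulling back to `V(toricStrict B g)`. [OURS · L1 W4.5b · ND-K5 (B4α1i) core] -/
theorem modelInit_chart {g : MvPolynomial (Fin (m + 1)) k} (hconv : IsConvenientTable (table g)) (hg : g ≠ 0)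
    {A₂ : Scheme.{0}} (π₀ : A₂ ⟶ Aff (m + 1) k)
    (hπ₀ : IsBlowup π₀ (vanishingIdeal (⟨{affOrigin (m + 1) k}, isClosed_affOrigin (m + 1) k⟩ : Closeds (Aff (m + 1) k)))) (x : A₂) :
    ∃ σ ∈ star (orthantFan (m + 1)) (Finset.univ.image (e (m + 1))), ∃ (B : Fin (m + 1) → Fin (m + 1) → ℕ) (c : Aff (m + 1) k ⟶ A₂),
      IsOpenImmersion c ∧ x ∈ Set.range c.base ∧
      σ = Finset.univ.image (fun i => rayOf (B i)) ∧ IsUnit (zMat B).det ∧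
      c ≫ π₀ = Spec.map (CommRingCat.ofHom (aeval fun l => ∏ i, (X i : MvPolynomial (Fin (m + 1)) k) ^ B i l).toRingHom) ∧
      (∀ i, (((frameBoundary (coordHyperplane (m + 1) k)).stepAlong
          (vanishingIdeal (⟨{affOrigin (m + 1) k}, isClosed_affOrigin (m + 1) k⟩ : Closeds (Aff (m + 1) k))) 1 π₀) (rayOf (B i))).comap c =
        coordHyperplane (m + 1) k i) ∧
      (∀ ρ, ρ ∉ σ → (((frameBoundary (coordHyperplane (m + 1) k)).stepAlong
          (vanishingIdeal (⟨{affOrigin (m + 1) k}, isClosed_affOrigin (m + 1) k⟩ : Closeds (Aff (m + 1) k))) 1 π₀) ρ).comap c = ⊤) ∧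
      c ⁻¹' closure (π₀ ⁻¹' (PrimeSpectrum.zeroLocus {g} \ {affOrigin (m + 1) k})) = PrimeSpectrum.zeroLocus {toricStrict B g} := by
  classical
  -- the blow-up as a coordinate blow-up of the full frame
  have hI := vanishingIdeal_affOrigin_eq m k
  have hπ : IsBlowup π₀ (AffineCoordBlowup.𝓘Λ m k Set.univ) := hI ▸ hπ₀
  haveI : IsLocallyNoetherian A₂ := hπ.isLocallyNoetherian
  -- the point lies in some chart
  have hcov := AffineCoordBlowup.iSup_chart hπ
  have hx' : ∃ i : (Set.univ : Set (Fin (m + 1))), x ∈ AffineCoordBlowup.chart Set.univ π₀ (i : Fin (m + 1)) :=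
    Opens.mem_iSup.mp (by rw [hcov]; trivial)
  obtain ⟨⟨j, hj⟩, hxj⟩ := hx'
  let c : Aff (m + 1) k ⟶ A₂ := AffineCoordBlowup.chartImm hπ hj
  have hcomp : c ≫ π₀ = Spec.map (CommRingCat.ofHom (coordBlowupSubst k (Set.univ : Set (Fin (m + 1))) j).toRingHom) :=
    AffineCoordBlowup.chartImm_comp hπ hj
  have hsq : c ≫ π₀ = Spec.map (CommRingCat.ofHom (coordBlowupSubst k (Set.univ : Set (Fin (m + 1))) j).toRingHom) ≫ 𝟙 _ := by
    rw [Category.comp_id]; exact hcomp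
  -- the centre as `idealSheafOf`
  have hI₀' : vanishingIdeal (⟨{affOrigin (m + 1) k}, isClosed_affOrigin (m + 1) k⟩ : Closeds (Aff (m + 1) k)) =
      Hironaka2005.idealSheafOf (Ideal.span (X '' (Set.univ : Set (Fin (m + 1))))) := by
    rw [hI, 𝓘Λ_eq_idealSheafOf]
  -- the strict transform of a coordinate hyperplane in the chart
  have hst : ∀ i : Fin (m + 1),
      (strictTransformIdeal π₀ (vanishingIdeal (⟨{affOrigin (m + 1) k}, isClosed_affOrigin (m + 1) k⟩ : Closeds (Aff (m + 1) k)))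
          (coordHyperplane (m + 1) k i)).comap c =
        Hironaka2005.idealSheafOf (coordStrictTransformIdeal k (Set.univ : Set (Fin (m + 1))) j (Ideal.span {(X i : MvPolynomial (Fin (m + 1)) k)})) := by
    intro i
    rw [comap_strictTransformIdeal_of_flat (𝟙 (Aff (m + 1) k)) hsq, Scheme.IdealSheafData.comap_id, Scheme.IdealSheafData.comap_id, hI₀',
      coordHyperplane_eq_idealSheafOf, AlgHom.toRingHom_eq_coe, strictTransformIdeal_specMap_coordBlowupSubst k Set.univ j hj]
  refine ⟨pointCone m j, pointCone_mem_star m j, pointChartMat m j, c, inferInstance, ?_, rfl, isUnit_det_zMat_pointChartMat m j, ?_, ?_, ?_, ?_⟩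
  · -- x ∈ range c
    have : x ∈ (c.opensRange : Set A₂) := by rw [AffineCoordBlowup.opensRange_chartImm hπ hj]; exact hxj
    exact this
  · -- c ≫ π₀ = Spec (toricChartHom B)
    rw [toricChartHom_pointChartMat]; exact hcomp
  · -- the boundary on the cone's rays
    intro i
    by_cases hij : i = j
    · subst hij
      rw [rayOf_pointChartMat_self, stepAlong_self, ← Scheme.IdealSheafData.comap_comp, hcomp, hI₀', AlgHom.toRingHom_eq_coe,
        Hironaka2005.comap_specMap_idealSheafOf, Ideal.map_coe, map_coordBlowupSubst_span_eq k Set.univ i hj, coordHyperplane_eq_idealSheafOf]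
    · have hne : e (m + 1) i ≠ 1 := by
        intro h; have := congrFun h j; simp [e, hij] at this
      rw [rayOf_pointChartMat_of_ne m hij, stepAlong_of_ne _ _ hne, frameBoundary_e, hst i,
        coordStrictTransformIdeal_span_singleton k Set.univ j hj (X_ne_zero i), coordProperTransform_X_of_ne k Set.univ j hij,
        coordHyperplane_eq_idealSheafOf]
  · -- the boundary off the cone
    intro ρ hρ
    have hρ1 : ρ ≠ 1 := by
      intro h; apply hρ; rw [h, pointCone_eq]; exact Finset.mem_insert_self _ _
    rw [stepAlong_of_ne _ _ hρ1]
    by_cases hρe : ρ ∈ Set.range (e (m + 1))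
    · obtain ⟨i, rfl⟩ := hρe
      have hij : i = j := by
        by_contra hij
        apply hρ
        rw [pointCone_eq, Finset.mem_insert, Finset.mem_erase]
        refine Or.inr ⟨?_, Finset.mem_image.mpr ⟨i, Finset.mem_univ _, rfl⟩⟩
        intro h; have := congrFun h i; simp [e, hij] at this
      subst hij
      rw [frameBoundary_e, hst i, coordStrictTransformIdeal_eq_top_of_X_mem k Set.univ i (Ideal.mem_span_singleton_self _), idealSheafOf_top']
    · rw [frameBoundary_of_not_mem_range _ hρe, strictTransformIdeal_top, Scheme.IdealSheafData.comap_top]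
  · -- the strict transform of `V(g)` in the chart
    have hopen : IsOpenMap c.base := c.isOpenEmbedding.isOpenMap
    have hpre : ∀ S : Set (Aff (m + 1) k), c.base ⁻¹' (π₀.base ⁻¹' S) = (c ≫ π₀).base ⁻¹' S := fun S => rfl
    rw [hopen.preimage_closure_eq_closure_preimage c.base.hom.continuous, hpre, hcomp,
      Set.preimage_sdiff, preimage_specMap_zeroLocus, preimage_specMap_coordBlowupSubst_affOrigin]
    change closure (PrimeSpectrum.zeroLocus {coordBlowupSubst k (Set.univ : Set (Fin (m + 1))) j g} \ _) = _
    rw [coordBlowupSubst_eq_chartPull]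
    have hdet := zdet_ne_zero_of_isUnit (pointChartMat m j) (isUnit_det_zMat_pointChartMat m j)
    have hinj : Set.InjOn (chartExp (pointChartMat m j)) (table g) := (chartExp_injective_of_det_ne_zero _ hdet).injOn
    have hz : ∀ i, i ≠ j → hVec (pointChartMat m j) (table g) i = 0 := by
      intro i hij
      refine hVec_eq_zero_of_frameRow hconv (pointChartMat m j) (l₀ := i) (l₁ := j) (Ne.symm hij) ?_
      funext l; simp only [pointChartMat, if_neg hij]; by_cases h : i = l <;> simp [h, eq_comm]
    rw [zeroLocus_chartPull_diff_eq _ g j hz]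
    exact closure_zeroLocus_diff_zeroLocus_of_not_dvd (prime_X_of_isDomain k j) (not_X_dvd_toricStrict _ g hinj hg j)

end Summit.ResolutionOfSingularities.ResolutionOfSingularities.Cruxes.EquisingularLiftNat.Sections.ND

end
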